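import Summits.CriticalPhenomena.PercolationContinuityZ3.Theorems.PercNearOneGluingNoHeavyLowerTailAntitheticChangeCube
import Summits.CriticalPhenomena.PercolationContinuityZ3.Theorems.PercNearOneGluingNoHeavyLowerTailAntitheticChangeQuad
import HarnessLib

/-!
# `NoHeavyLowerTail` (stmt-CriticalPhenomena-4575) — antithetic cluster pairs: THEOREM P (PENDANT SOURCE) — CONJECTURE Δ2 holds at a
# degree-2 vertex `x ∈ R` ADJACENT TO A DEGREE-2 SOURCE, on EVERY graph (prim-hp-2 gen 45; HOME/MEMO-gen45.md §0)

Support file (`--supports stmt-CriticalPhenomena-4575`, hull-port prover `prim-hp-2`, gen 45).  No definitions, no named facts, no sorries.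

SETTING (…AntitheticContract/…ChangeCube): `x ≠ s` meets exactly the pairs `e = xs` and `f = xz` of `E`; the CHANGE PART of the deg-2
elimination identity `Contract.deg2_decomposition` is `Σ_{ω ∈ tset_E(R,X), e ≢ f} Δ_E(F,G)(ω)`; CONJECTURE Δ2 (MEMO-gen40 §3) says it is `≥ 0` when
`x ∈ R`.  Here the FIRST NEIGHBOUR OF `x` IS THE SOURCE and the source has degree 2: its pairs in `E` are `e` and `g = st`.
* `Antithetic.PendantSource.change_nonneg` — **THEOREM P**: under these hypotheses the change part is `≥ 0` for all monotone `F, G`, every `R ∋ x`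
  and `X ∌ x` — with NO assumption on the rest of the graph.  By `Contract.good_of_change_nonneg` the degree-2 elimination of such an `x` is a valid
  reduction step (census class "source inside an ear, next to `x`", HOME/MEMO-gen45 §0).
PROOF.  By `Change.change_nonneg_of_half` (with `y = s`) it suffices to show `0 ≤ Σ_ω (F(C ∪ e) − F(C′))(G(C ∪ e) − G(C′))` over the colourings `ω`
of `H = G − x` (pairs `E₀ = E ∖ {e,f}`) in `tset_{E₀}(R,X)` with `e ∈ ω ∌ f` whose blue cluster does not reach `z` (`C, C′` the red / blue edge
clusters of `s` in `H`; the marker `e` is always attached since `y = s`, the marker `f` never, by the constraint).  In `H` the source is a LEAF (only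
pair `g`): if `g` is red then `C′ = ∅` and the term is `(F(C ∪ e) − F ∅)(G(C ∪ e) − G ∅) ≥ 0`; if `g` is blue then `C = ∅` and the term is
`(F{e} − F C′)(G{e} − G C′)`.  The involution `ω ↦ ω ∆ E₀` (flip the colours of `H`, keep `e, f`) maps the second kind injectively into the first
with `C(ω ∆ E₀) = C′(ω)`, and each pair of terms is `Δ(C′ ∪ e, ∅) + Δ({e}, C′) ≥ 0` by the four-value inequality (`Quad.arcs_pair`: the arc `C′ ∪ e`
contains both `{e}` and `C′`).  Machine-checked (exact min over up-set pairs, all graphs `n ≤ 5`, random `n ≤ 7`: kit j198571).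
[cite: VandenbergHaggstromKahn2005, §1 p. 3 (open cluster `C_s`)]
-/

noncomputable section

namespace Summit.CriticalPhenomena.PercolationContinuityZ3.Theorems

open Literature.Probability.Percolation
open scoped Classical symmDiff

namespace Antithetic

namespace PendantSource

variable {V : Type*}

/-- A vertex met by no (non-diagonal) pair of `η` reaches only itself. [folklore] -/
theorem not_reachable_of_isolated {η : Set (Sym2 V)} {s v : V} (hs : ∀ h ∈ η, s ∈ h → h.IsDiag) (hvs : v ≠ s) :
    ¬ (openGraph η).Reachable s v := by
  rintro ⟨p⟩
  cases p with
  | nil => exact hvs rfl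
  | cons hadj _ =>
    rw [openGraph_adj] at hadj
    exact hadj.2 (Sym2.mk_isDiag_iff.1 (hs _ hadj.1 (Sym2.mem_mk_left _ _)))

/-- The edge cluster of an isolated source is empty. [cite: VandenbergHaggstromKahn2005, §1 p. 3 (open cluster `C_s`)] -/
theorem cluster_eq_empty {η : Set (Sym2 V)} {s : V} (hs : ∀ h ∈ η, s ∈ h → h.IsDiag) : openEdgeCluster η s = ∅ := by
  refine Set.eq_empty_of_forall_notMem fun h hh => ?_
  rw [mem_openEdgeCluster_iff] at hh
  obtain ⟨-, hnd, hr⟩ := hh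
  have hall : ∀ v ∈ h, v = s := fun v hv => by
    by_contra hne
    exact not_reachable_of_isolated hs hne (hr v hv)
  induction h using Sym2.ind with
  | h a b => exact hnd (Sym2.mk_isDiag_iff.2 ((hall a (Sym2.mem_mk_left a b)).trans (hall b (Sym2.mem_mk_right a b)).symm))

/-- Flipping the colours on a set `D` of pairs: `(ω ∆ D) ∩ D = ωᶜ ∩ D`. [folklore] -/
theorem symmDiff_inter_self (ω D : Set (Sym2 V)) : (ω ∆ D) ∩ D = ωᶜ ∩ D := by
  ext h
  simp only [Set.mem_inter_iff, Set.mem_symmDiff, Set.mem_compl_iff]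
  tauto

/-- Flipping the colours on `D`: `(ω ∆ D)ᶜ ∩ D = ω ∩ D`. [folklore] -/
theorem compl_symmDiff_inter_self (ω D : Set (Sym2 V)) : (ω ∆ D)ᶜ ∩ D = ω ∩ D := by
  ext h
  simp only [Set.mem_inter_iff, Set.mem_compl_iff, Set.mem_symmDiff]
  tauto

/-- Flipping the colours on `D` does not move pairs outside `D`. [folklore] -/
theorem mem_symmDiff_of_notMem {ω D : Set (Sym2 V)} {h : Sym2 V} (hD : h ∉ D) : h ∈ ω ∆ D ↔ h ∈ ω := by
  rw [Set.mem_symmDiff]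
  tauto

variable [Fintype V] {E : Set (Sym2 V)} {s x z t : V}

/-- **THEOREM P (pendant source).**  `x ≠ s` has exactly the pairs `e = xs`, `f = xz` in `E` (`z ≠ s`), and `s` has exactly the pairs `e` and
`g = st` (`t ≠ x`).  Then for all monotone `F, G`, every `R ∋ x` and `X ∌ x` the change part of the deg-2 elimination of `x` is nonnegative:
`0 ≤ Σ_{ω ∈ tset_E(R,X), e ≢ f} Δ_E(F,G)(ω)`. [this work] -/
theorem change_nonneg (hxs : x ≠ s) (hxz : x ≠ z) (hzs : z ≠ s) (htx : t ≠ x)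
    (he : s(x, s) ∈ E) (hf : s(x, z) ∈ E) (hg : s(s, t) ∈ E)
    (hdeg : ∀ h ∈ E, x ∈ h → h = s(x, s) ∨ h = s(x, z)) (hdegs : ∀ h ∈ E, s ∈ h → h = s(x, s) ∨ h = s(s, t))
    {F G : Set (Sym2 V) → ℝ} (hF : Monotone F) (hG : Monotone G) (R X : Set V) (hxR : x ∈ R) (hxX : x ∉ X) :
    0 ≤ ∑ ω ∈ (Peel.tset E s R X).filter (fun ω => ¬ (s(x, s) ∈ ω ↔ s(x, z) ∈ ω)), Peel.delta F G E s ω := by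
  refine Change.change_nonneg_of_half hxs hxs hxz he hf hdeg F G R X hxR hxX ?_
  set E₀ : Set (Sym2 V) := E \ {s(x, s), s(x, z)} with hE₀
  have heE₀ : s(x, s) ∉ E₀ := fun h => h.2 (Set.mem_insert _ _)
  have hfE₀ : s(x, z) ∉ E₀ := fun h => h.2 (Set.mem_insert_of_mem _ (Set.mem_singleton _))
  have hge : s(s, t) ≠ s(x, s) := fun h => by
    rcases Sym2.eq_iff.1 h with ⟨h1, -⟩ | ⟨-, h2⟩
    · exact hxs h1.symm
    · exact htx h2
  have hgf : s(s, t) ≠ s(x, z) := fun h => by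
    rcases Sym2.eq_iff.1 h with ⟨h1, -⟩ | ⟨h1, -⟩
    · exact hxs h1.symm
    · exact hzs h1.symm
  have hgE₀ : s(s, t) ∈ E₀ := ⟨hg, fun h => h.elim hge fun h => hgf (Set.mem_singleton_iff.1 h)⟩
  -- the source is a leaf of `H`: a pair of `η ∩ E₀` at `s` not containing... is `g`
  have isol : ∀ η : Set (Sym2 V), s(s, t) ∉ η → ∀ h ∈ η ∩ E₀, s ∈ h → h.IsDiag := by
    intro η hη h hh hsh
    rcases hdegs h hh.2.1 hsh with rfl | rfl
    · exact absurd hh.2 heE₀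
    · exact absurd hh.1 hη
  -- Step A: rewrite the summand (lift at `y = s` always, lift at `z` never)
  rw [Finset.sum_congr rfl fun ω hω => (?_ :
    (F (Pendant.liftSet s s s(x, s) (openEdgeCluster (ω ∩ E₀) s)) - F (Pendant.liftSet s z s(x, z) (openEdgeCluster (ωᶜ ∩ E₀) s))) *
      (G (Pendant.liftSet s s s(x, s) (openEdgeCluster (ω ∩ E₀) s)) - G (Pendant.liftSet s z s(x, z) (openEdgeCluster (ωᶜ ∩ E₀) s))) =
    (F (insert s(x, s) (openEdgeCluster (ω ∩ E₀) s)) - F (openEdgeCluster (ωᶜ ∩ E₀) s)) *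
      (G (insert s(x, s) (openEdgeCluster (ω ∩ E₀) s)) - G (openEdgeCluster (ωᶜ ∩ E₀) s)))]
  swap
  · rw [Finset.mem_filter] at hω
    have hz : ¬ (openGraph (ωᶜ ∩ E₀)).Reachable s z := fun h => hω.2.2.2 ⟨SimpleGraph.Reachable.refl s, h⟩
    have hz' : ¬ (z = s ∨ ∃ g ∈ openEdgeCluster (ωᶜ ∩ E₀) s, z ∈ g) :=
      fun h => hz ((Pendant.reachable_iff_cluster (ωᶜ ∩ E₀) z s).2 h)
    have h1 : Pendant.liftSet s s s(x, s) (openEdgeCluster (ω ∩ E₀) s) = insert s(x, s) (openEdgeCluster (ω ∩ E₀) s) := by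
      unfold Pendant.liftSet; rw [if_pos (Or.inl rfl)]
    rw [h1, Quad.liftSet_of_not hz']
  -- Step B: split by the colour of `g`
  set S := (Peel.tset E₀ s R X).filter (fun ω => s(x, s) ∈ ω ∧ s(x, z) ∉ ω ∧
      ¬ ((openGraph (ω ∩ E₀)).Reachable s s ∧ (openGraph (ωᶜ ∩ E₀)).Reachable s z)) with hS
  set T : Set (Sym2 V) → ℝ := fun ω => (F (insert s(x, s) (openEdgeCluster (ω ∩ E₀) s)) - F (openEdgeCluster (ωᶜ ∩ E₀) s)) *
      (G (insert s(x, s) (openEdgeCluster (ω ∩ E₀) s)) - G (openEdgeCluster (ωᶜ ∩ E₀) s)) with hT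
  rw [← Finset.sum_filter_add_sum_filter_not S (fun ω => s(s, t) ∈ ω)]
  -- the arc value `A ω = Δ(C ∪ e, ∅)` and the involution
  set A : Set (Sym2 V) → ℝ := fun ω => (F (insert s(x, s) (openEdgeCluster (ω ∩ E₀) s)) - F ∅) *
      (G (insert s(x, s) (openEdgeCluster (ω ∩ E₀) s)) - G ∅) with hA
  have hA0 : ∀ ω, 0 ≤ A ω := fun ω =>
    mul_nonneg (sub_nonneg.2 (hF (Set.empty_subset _))) (sub_nonneg.2 (hG (Set.empty_subset _)))
  -- on `S₁` (g red) the blue cluster is empty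
  have hS1 : ∀ ω ∈ S.filter (fun ω => s(s, t) ∈ ω), T ω = A ω := by
    intro ω hω
    rw [Finset.mem_filter] at hω
    have hiso : ∀ h ∈ ωᶜ ∩ E₀, s ∈ h → h.IsDiag := isol ωᶜ (fun h => h hω.2)
    simp only [hT, hA, cluster_eq_empty hiso]
  -- on `S₂` (g blue) the red cluster is empty
  have hS2 : ∀ ω ∈ S.filter (fun ω => ¬ s(s, t) ∈ ω), openEdgeCluster (ω ∩ E₀) s = ∅ := by
    intro ω hω
    rw [Finset.mem_filter] at hω
    exact cluster_eq_empty (isol ω hω.2)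
  -- the involution `φ ω = ω ∆ E₀` maps `S₂` into `S₁`
  have hφmem : ∀ ω ∈ S.filter (fun ω => ¬ s(s, t) ∈ ω), ω ∆ E₀ ∈ S.filter (fun ω => s(s, t) ∈ ω) := by
    intro ω hω
    have hC := hS2 ω hω
    rw [Finset.mem_filter, hS, Finset.mem_filter, Peel.mem_tset] at hω
    obtain ⟨⟨⟨hR, hX⟩, heω, hfω, -⟩, hgω⟩ := hω
    rw [Finset.mem_filter, hS, Finset.mem_filter, Peel.mem_tset, symmDiff_inter_self, compl_symmDiff_inter_self,
      mem_symmDiff_of_notMem heE₀, mem_symmDiff_of_notMem hfE₀]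
    refine ⟨⟨⟨fun r hr h => hR r hr ⟨h.2, h.1⟩, fun v hv => ⟨(hX v hv).2, (hX v hv).1⟩⟩, heω, hfω, fun h => ?_⟩, ?_⟩
    · exact not_reachable_of_isolated (isol ω hgω) hzs h.2
    · rw [Set.mem_symmDiff]
      exact Or.inr ⟨hgE₀, hgω⟩
  have hφinj : Set.InjOn (fun ω : Set (Sym2 V) => ω ∆ E₀) ↑(S.filter (fun ω => ¬ s(s, t) ∈ ω)) := by
    intro ω₁ _ ω₂ _ h
    have := congrArg (fun ω : Set (Sym2 V) => ω ∆ E₀) h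
    simpa only [symmDiff_symmDiff_cancel_right] using this
  -- Step C: the estimate
  have hsum1 : ∑ ω ∈ S.filter (fun ω => s(s, t) ∈ ω), T ω = ∑ ω ∈ S.filter (fun ω => s(s, t) ∈ ω), A ω :=
    Finset.sum_congr rfl hS1
  have himg : (S.filter (fun ω => ¬ s(s, t) ∈ ω)).image (fun ω => ω ∆ E₀) ⊆ S.filter (fun ω => s(s, t) ∈ ω) := by
    intro ω hω
    rw [Finset.mem_image] at hω
    obtain ⟨ω', hω', rfl⟩ := hω
    exact hφmem ω' hω'
  have hle : ∑ ω ∈ S.filter (fun ω => ¬ s(s, t) ∈ ω), A (ω ∆ E₀) ≤ ∑ ω ∈ S.filter (fun ω => s(s, t) ∈ ω), A ω := by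
    rw [← Finset.sum_image hφinj]
    exact Finset.sum_le_sum_of_subset_of_nonneg himg fun ω _ _ => hA0 ω
  have hpair : ∀ ω ∈ S.filter (fun ω => ¬ s(s, t) ∈ ω), 0 ≤ A (ω ∆ E₀) + T ω := by
    intro ω hω
    have hC := hS2 ω hω
    simp only [hA, hT, symmDiff_inter_self, hC]
    exact Quad.arcs_pair hF hG (Set.insert_subset_insert (Set.empty_subset _)) (Set.subset_insert _ _)
  have h2 := Finset.sum_nonneg hpair
  rw [Finset.sum_add_distrib] at h2
  rw [hsum1]
  linarith

end PendantSource

end Antithetic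

end Summit.CriticalPhenomena.PercolationContinuityZ3.Theorems
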